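import Mathlib
import HarnessLib
import Summits.NavierStokesRegularity.NavierStokesRegularity.Theorems.WakeRatchetMinimalViscousBlowupEveryShellFires
import Summits.NavierStokesRegularity.NavierStokesRegularity.Theorems.WakeRatchetMinimalViscousBlowupEnergyBudget
import Summits.NavierStokesRegularity.NavierStokesRegularity.Theorems.WakeRatchetMinimalViscousBlowupThresholdContinuity

/-!
# Route `WakeRatchet`, crux `MinimalViscousBlowup` (stmt-NavierStokesRegularity-22743) — LINE g12-2 (ns-idea-1 g12, card «monotone quantity hunt»):
# THE CRITICAL SUP-LEVEL IS A ONE-SIDED LYAPUNOV FUNCTIONAL, part 1/2 — levels, bond fluxes, and the two-level bootstrap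

ns-idea-1 g12's kernel-checked helper `lines/g12-2/SupLevelMaxPrinciple.lean` (sha16 a882c26a9cc9956b, 551 l.), landed VERBATIM by the hand
ns-qj-p1 g7 in two files (tree files ≤ 400 lines): this part = §1 `normSq_le_of_level`, `norm_le_of_level`, `rpow_five_half_eq_sqrt_pow`,
`abs_botSum_le_of_levels`, `abs_botSum_le_of_level_succ` and §2 `level_bootstrap`; part 2/2 = `…SupLevelMaxPrinciple.lean` (`levels_tail_lt`,
`supLevel_maxPrinciple`, `noGlobalLull`).

MODEL lattice ODEs only (Tao-type cascade, `m = 4`); nothing here concerns the Navier–Stokes equations (no NS regularity statement is proved).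

For a regular trajectory of the `ν`-viscous lattice the scale-invariant levels `ℓ_n(t) = λⁿ‖X_n(t)‖²` (`λ = 1+ε₀`) obey, shell by
shell, `d/dt ‖X_n‖² = 2Π_{n−1} − 2Π_n − 2νλ^{2n}‖X_n‖²` with `|Π_n| ≤ 64 λ^{5n/2}‖X_n‖²‖X_{n+1}‖`.  If every level is `≤ L₁` with
`128√L₁ < ν`, the inflow into shell `n` is `≤ 64 L₁^{3/2} λ^{n−1}` while dissipation minus outflow drains at rate `≥ (ν − 64√L₁)λ^{2n}‖X_n‖²`,
so each level is fenced below `max(ℓ_n(t₀), 128 L₁^{3/2}/ν) < L₁`: a two-level bootstrap (`level_bootstrap`, this file) closed by real induction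
(`supLevel_maxPrinciple`, part 2).  `--supports stmt-NavierStokesRegularity-22743 --as helper`.
[cite: Tao2016AveragedNS, §4 (4.1)–(4.3), Lemma 4.1 (4.5); BarbatoMorandinRomito2011, §3.1]
-/

noncomputable section

set_option linter.dupNamespace false

open Set Filter Topology MeasureTheory
open Literature.Analysis.FluidPDE Literature.Analysis.FluidPDE.TaoCascade

namespace Summit.NavierStokesRegularity.NavierStokesRegularity.Theorems.MinimalViscousBlowup.ThresholdRay

/-! ### §1 Levels and bond fluxes -/

/-- `‖X_n‖² ≤ L λ^{−n}` from the level bound `λⁿ‖X_n‖² ≤ L`. [folklore] -/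
theorem normSq_le_of_level {ε₀ L : ℝ} (hl0 : 0 < 1 + ε₀) {X : Fin 4 → ℤ → ℝ → ℝ} {n : ℕ} {t : ℝ}
    (h : (1 + ε₀) ^ n * ‖shellVec X n t‖ ^ 2 ≤ L) : ‖shellVec X n t‖ ^ 2 ≤ L * ((1 + ε₀)⁻¹) ^ n := by
  rw [inv_pow, ← div_eq_mul_inv, le_div_iff₀ (pow_pos hl0 n)]
  linarith [mul_comm ((1 + ε₀) ^ n) (‖shellVec X n t‖ ^ 2)]

/-- `‖X_n‖ ≤ √L · (√(λ⁻¹))ⁿ` from the level bound `λⁿ‖X_n‖² ≤ L`. [folklore] -/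
theorem norm_le_of_level {ε₀ L : ℝ} (hl0 : 0 < 1 + ε₀) (hL : 0 ≤ L) {X : Fin 4 → ℤ → ℝ → ℝ} {n : ℕ} {t : ℝ}
    (h : (1 + ε₀) ^ n * ‖shellVec X n t‖ ^ 2 ≤ L) :
    ‖shellVec X n t‖ ≤ Real.sqrt L * Real.sqrt ((1 + ε₀)⁻¹) ^ n := by
  have h1 := normSq_le_of_level hl0 h
  have hρ : ((1 + ε₀)⁻¹) ^ n = (Real.sqrt ((1 + ε₀)⁻¹) ^ n) ^ 2 := by
    rw [← pow_mul, show n * 2 = 2 * n by ring, pow_mul, Real.sq_sqrt (inv_nonneg.2 hl0.le)]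
  calc ‖shellVec X n t‖ = Real.sqrt (‖shellVec X n t‖ ^ 2) := (Real.sqrt_sq (norm_nonneg _)).symm
    _ ≤ Real.sqrt (L * ((1 + ε₀)⁻¹) ^ n) := Real.sqrt_le_sqrt h1
    _ = Real.sqrt L * Real.sqrt ((1 + ε₀)⁻¹) ^ n := by
        rw [Real.sqrt_mul hL, hρ, Real.sqrt_sq (pow_nonneg (Real.sqrt_nonneg _) n)]

/-- The flux weight `λ^{5n/2}` as a power of `√λ`. [folklore] -/
theorem rpow_five_half_eq_sqrt_pow {ε₀ : ℝ} (hl0 : 0 < 1 + ε₀) (n : ℕ) :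
    (1 + ε₀) ^ ((5 : ℝ) * ((n : ℕ) : ℤ) / 2) = Real.sqrt (1 + ε₀) ^ (5 * n) := by
  have he : (5 : ℝ) * (((n : ℕ) : ℤ) : ℝ) / 2 = (1 / 2 : ℝ) * ((5 * n : ℕ) : ℝ) := by push_cast; ring
  rw [he, Real.rpow_mul hl0.le, Real.rpow_natCast, ← Real.sqrt_eq_rpow]

/-- **Bond flux under level bounds (inflow form).**  If shells `n` and `n+1` have level `≤ L`, then `|Π_n| ≤ 64 L^{3/2} λⁿ`
(`|Π_n| ≤ 4³λ^{5n/2}‖X_n‖²‖X_{n+1}‖`, `‖X_n‖² ≤ Lλ^{−n}`, `‖X_{n+1}‖ ≤ √L λ^{−(n+1)/2}`). [cite: Tao2016AveragedNS, §4 (4.1)–(4.2)] -/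
theorem abs_botSum_le_of_levels {ε₀ L : ℝ} (hε : 0 < ε₀) (hL : 0 ≤ L) {α : Fin 4 → Fin 4 → Fin 4 → ℤ × ℤ × ℤ → ℝ}
    (hα1 : ∀ i₁ i₂ i₃, |α i₁ i₂ i₃ (0, 0, 1)| ≤ 1) (X : Fin 4 → ℤ → ℝ → ℝ) {n : ℕ} {t : ℝ}
    (hn : (1 + ε₀) ^ n * ‖shellVec X n t‖ ^ 2 ≤ L)
    (hn1 : (1 + ε₀) ^ (n + 1) * ‖shellVec X ((n + 1 : ℕ) : ℤ) t‖ ^ 2 ≤ L) :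
    |botSum ε₀ α X n t| ≤ 64 * L * Real.sqrt L * (1 + ε₀) ^ n := by
  have hl0 : (0 : ℝ) < 1 + ε₀ := by linarith
  have hl1 : (1 : ℝ) ≤ 1 + ε₀ := by linarith
  have h1 : ‖shellVec X n t‖ ^ 2 ≤ L * ((1 + ε₀)⁻¹) ^ n := normSq_le_of_level hl0 hn
  have h2 : ‖shellVec X ((n : ℤ) + 1) t‖ ≤ Real.sqrt L * Real.sqrt ((1 + ε₀)⁻¹) ^ (n + 1) := by
    have := norm_le_of_level hl0 hL hn1
    push_cast at this
    exact this
  have hb := abs_botSum_le_norm_shellVec hl0 hα1 X (n : ℤ) t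
  have hW := rpow_five_half_eq_sqrt_pow hl0 n
  set s : ℝ := Real.sqrt (1 + ε₀) with hs
  set ρ : ℝ := Real.sqrt ((1 + ε₀)⁻¹) with hρ
  set r : ℝ := (1 + ε₀)⁻¹ with hr
  have hs0 : 0 ≤ s := by rw [hs]; exact Real.sqrt_nonneg _
  have hρ0 : 0 ≤ ρ := by rw [hρ]; exact Real.sqrt_nonneg _
  have hρ1 : ρ ≤ 1 := by
    rw [hρ, hr]; exact Real.sqrt_le_one.mpr (inv_le_one_of_one_le₀ hl1)
  have hss : s ^ 2 = 1 + ε₀ := by rw [hs]; exact Real.sq_sqrt hl0.le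
  have hr0 : 0 ≤ r := by rw [hr]; exact inv_nonneg.2 hl0.le
  have hρρ : ρ ^ 2 = r := by rw [hρ]; exact Real.sq_sqrt (by rw [hr]; exact inv_nonneg.2 hl0.le)
  have hsρ : s * ρ = 1 := by
    rw [hs, hρ, ← Real.sqrt_mul hl0.le, hr, mul_inv_cancel₀ hl0.ne', Real.sqrt_one]
  have hLs : 0 ≤ Real.sqrt L := Real.sqrt_nonneg _
  clear_value s ρ r
  have hweight : s ^ (5 * n) * r ^ n * ρ ^ (n + 1) = (1 + ε₀) ^ n * ρ := by
    have : s ^ (5 * n) * r ^ n * ρ ^ (n + 1) = (s ^ 2 * (s * ρ) ^ 3) ^ n * ρ := by rw [← hρρ]; ring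
    rw [this, hsρ, one_pow, mul_one, hss]
  calc |botSum ε₀ α X n t|
      ≤ (4 : ℝ) ^ 3 * (1 + ε₀) ^ ((5 : ℝ) * ((n : ℕ) : ℤ) / 2) * ‖shellVec X n t‖ ^ 2 *
          ‖shellVec X ((n : ℤ) + 1) t‖ := by exact_mod_cast hb
    _ ≤ (4 : ℝ) ^ 3 * s ^ (5 * n) * (L * r ^ n) * (Real.sqrt L * ρ ^ (n + 1)) := by
        rw [hW]
        exact mul_le_mul (mul_le_mul_of_nonneg_left h1 (by positivity)) h2 (norm_nonneg _) (by positivity)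
    _ = 64 * L * Real.sqrt L * (s ^ (5 * n) * r ^ n * ρ ^ (n + 1)) := by ring
    _ = 64 * L * Real.sqrt L * (1 + ε₀) ^ n * ρ := by rw [hweight]; ring
    _ ≤ 64 * L * Real.sqrt L * (1 + ε₀) ^ n := mul_le_of_le_one_right (by positivity) hρ1

/-- **Bond flux under level bounds (outflow form).**  If shell `n+1` has level `≤ L`, then `|Π_n| ≤ 64 √L λ^{2n} ‖X_n‖²`.
[cite: Tao2016AveragedNS, §4 (4.1)–(4.2)] -/
theorem abs_botSum_le_of_level_succ {ε₀ L : ℝ} (hε : 0 < ε₀) (hL : 0 ≤ L) {α : Fin 4 → Fin 4 → Fin 4 → ℤ × ℤ × ℤ → ℝ}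
    (hα1 : ∀ i₁ i₂ i₃, |α i₁ i₂ i₃ (0, 0, 1)| ≤ 1) (X : Fin 4 → ℤ → ℝ → ℝ) {n : ℕ} {t : ℝ}
    (hn1 : (1 + ε₀) ^ (n + 1) * ‖shellVec X ((n + 1 : ℕ) : ℤ) t‖ ^ 2 ≤ L) :
    |botSum ε₀ α X n t| ≤ 64 * Real.sqrt L * (1 + ε₀) ^ (2 * n) * ‖shellVec X n t‖ ^ 2 := by
  have hl0 : (0 : ℝ) < 1 + ε₀ := by linarith
  have hl1 : (1 : ℝ) ≤ 1 + ε₀ := by linarith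
  have h2 : ‖shellVec X ((n : ℤ) + 1) t‖ ≤ Real.sqrt L * Real.sqrt ((1 + ε₀)⁻¹) ^ (n + 1) := by
    have := norm_le_of_level hl0 hL hn1
    push_cast at this
    exact this
  have hb := abs_botSum_le_norm_shellVec hl0 hα1 X (n : ℤ) t
  have hW := rpow_five_half_eq_sqrt_pow hl0 n
  set s : ℝ := Real.sqrt (1 + ε₀) with hs
  set ρ : ℝ := Real.sqrt ((1 + ε₀)⁻¹) with hρ
  have hs0 : 0 ≤ s := by rw [hs]; exact Real.sqrt_nonneg _
  have hρ0 : 0 ≤ ρ := by rw [hρ]; exact Real.sqrt_nonneg _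
  have hρ1 : ρ ≤ 1 := by
    rw [hρ]; exact Real.sqrt_le_one.mpr (inv_le_one_of_one_le₀ hl1)
  have hss : s ^ 2 = 1 + ε₀ := by rw [hs]; exact Real.sq_sqrt hl0.le
  have hsρ : s * ρ = 1 := by
    rw [hs, hρ, ← Real.sqrt_mul hl0.le, mul_inv_cancel₀ hl0.ne', Real.sqrt_one]
  have hLs : 0 ≤ Real.sqrt L := Real.sqrt_nonneg _
  clear_value s ρ
  have hweight : s ^ (5 * n) * ρ ^ (n + 1) = (1 + ε₀) ^ (2 * n) * ρ := by
    have : s ^ (5 * n) * ρ ^ (n + 1) = ((s ^ 2) ^ 2 * (s * ρ)) ^ n * ρ := by ring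
    rw [this, hsρ, mul_one, hss, ← pow_mul, mul_comm 2 n]
  have hy : 0 ≤ ‖shellVec X n t‖ ^ 2 := sq_nonneg _
  calc |botSum ε₀ α X n t|
      ≤ (4 : ℝ) ^ 3 * (1 + ε₀) ^ ((5 : ℝ) * ((n : ℕ) : ℤ) / 2) * ‖shellVec X n t‖ ^ 2 *
          ‖shellVec X ((n : ℤ) + 1) t‖ := by exact_mod_cast hb
    _ ≤ (4 : ℝ) ^ 3 * s ^ (5 * n) * ‖shellVec X n t‖ ^ 2 * (Real.sqrt L * ρ ^ (n + 1)) := by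
        rw [hW]
        exact mul_le_mul_of_nonneg_left h2 (by positivity)
    _ = 64 * Real.sqrt L * (s ^ (5 * n) * ρ ^ (n + 1)) * ‖shellVec X n t‖ ^ 2 := by ring
    _ = 64 * Real.sqrt L * (1 + ε₀) ^ (2 * n) * ‖shellVec X n t‖ ^ 2 * ρ := by rw [hweight]; ring
    _ ≤ 64 * Real.sqrt L * (1 + ε₀) ^ (2 * n) * ‖shellVec X n t‖ ^ 2 := mul_le_of_le_one_right (by positivity) hρ1

/-! ### §2 One fencing step: the two-level bootstrap -/

/-- **Level bootstrap.**  `λ = 1+ε₀`, `ν > 0`, a cancelling table with `|α_{··(0,0,1)}| ≤ 1`, a trajectory solving the `ν`-viscous lattice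
within `[0,T']` (no shells below `0`).  If all levels are `≤ L₀` at `t₀` and `≤ L₁` on `[t₀,x]` (`x < T'`, `L₀ ≤ L₁ < ν²/16384`), then all levels
are `≤ max(L₀, 128 L₁^{3/2}/ν)` on `[t₀,x]`: shell by shell, the energy `½‖X_n‖²` is fenced below `(max(L₀,128L₁^{3/2}/ν)+η)λ^{−n}/2`, because
at the fence the inflow `Π_{n−1} ≤ 64L₁^{3/2}λ^{n−1}` is beaten by dissipation minus outflow `≥ (ν − 64√L₁)λ^{2n}‖X_n‖²`.
[cite: Tao2016AveragedNS, §4 (4.1)–(4.3); BarbatoMorandinRomito2011, §3.1] -/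
theorem level_bootstrap {ε₀ ν T' L₀ L₁ t₀ x : ℝ} (hε : 0 < ε₀) (hν : 0 < ν)
    {α : Fin 4 → Fin 4 → Fin 4 → ℤ × ℤ × ℤ → ℝ} (hcan : IsCancellingCoeff α)
    (hα1 : ∀ i₁ i₂ i₃, |α i₁ i₂ i₃ (0, 0, 1)| ≤ 1) {X : Fin 4 → ℤ → ℝ → ℝ}
    (hlow : ∀ i n t, n < 0 → 0 ≤ t → X i n t = 0)
    (hder : ∀ (i : Fin 4) (k : ℤ), ∀ t ∈ Icc 0 T', HasDerivWithinAt (X i k)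
      (quadTerm ε₀ α X i k t - ν * (1 + ε₀) ^ ((2 : ℝ) * k) * X i k t) (Icc 0 T') t)
    (ht₀ : 0 ≤ t₀) (hxT' : x < T')
    (hL₀₁ : L₀ ≤ L₁) (hL₁ : L₁ < ν ^ 2 / 16384)
    (h0 : ∀ n : ℕ, (1 + ε₀) ^ n * ‖shellVec X n t₀‖ ^ 2 ≤ L₀)
    (hyp : ∀ τ ∈ Icc t₀ x, ∀ n : ℕ, (1 + ε₀) ^ n * ‖shellVec X n τ‖ ^ 2 ≤ L₁) :
    ∀ τ ∈ Icc t₀ x, ∀ n : ℕ,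
      (1 + ε₀) ^ n * ‖shellVec X n τ‖ ^ 2 ≤ max L₀ (128 * L₁ * Real.sqrt L₁ / ν) := by
  intro τ hτ n
  have hl0 : (0 : ℝ) < 1 + ε₀ := by linarith
  have hl1 : (1 : ℝ) < 1 + ε₀ := by linarith
  have hL₀0 : 0 ≤ L₀ := le_trans (by positivity) (h0 0)
  have hL₁0 : 0 ≤ L₁ := hL₀0.trans hL₀₁
  set σ : ℝ := Real.sqrt L₁ with hσ
  have hσ0 : 0 ≤ σ := by rw [hσ]; exact Real.sqrt_nonneg _
  have hσν : 128 * σ < ν := by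
    have h2 : Real.sqrt (ν ^ 2 / 16384) = ν / 128 := by
      rw [show ν ^ 2 / 16384 = (ν / 128) ^ 2 by ring, Real.sqrt_sq (by positivity)]
    have h1 : σ < ν / 128 := by rw [hσ, ← h2]; exact Real.sqrt_lt_sqrt hL₁0 hL₁
    linarith
  set K : ℝ := max L₀ (128 * L₁ * σ / ν) with hK
  have hKG : 128 * L₁ * σ / ν ≤ K := le_max_right _ _
  have hKL₀ : L₀ ≤ K := le_max_left _ _
  set r : ℝ := (1 + ε₀)⁻¹ with hr
  have hr0 : 0 < r := by rw [hr]; exact inv_pos.2 hl0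
  have hr1 : r ≤ 1 := by rw [hr]; exact inv_le_one_of_one_le₀ hl1.le
  have hPr : ∀ k : ℕ, (1 + ε₀) ^ k * r ^ k = 1 := fun k => by
    rw [hr, inv_pow, mul_inv_cancel₀ (pow_ne_zero _ hl0.ne')]
  have hrl : r * (1 + ε₀) = 1 := by rw [hr, inv_mul_cancel₀ hl0.ne']
  clear_value σ K r
  refine le_of_forall_pos_le_add fun η hη => ?_
  have hKη : 0 < K + η := by linarith
  -- the shell-`n` energy and its derivative
  obtain ⟨F, hF⟩ : ∃ F : ℝ → ℝ,
      F = fun w => ∑ k ∈ Finset.Ico n (n + 1), ∑ i : Fin 4, (1 / 2 : ℝ) * X i k w ^ 2 := ⟨_, rfl⟩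
  have hFeq : ∀ w, F w = 1 / 2 * ‖shellVec X n w‖ ^ 2 := by
    intro w
    rw [hF]
    simp only [Nat.Ico_succ_singleton, Finset.sum_singleton]
    rw [norm_shellVec_sq, Finset.mul_sum]
  obtain ⟨F', hF'⟩ : ∃ F' : ℝ → ℝ, F' = fun w => botSum ε₀ α X ((n : ℤ) - 1) w - botSum ε₀ α X (((n + 1 : ℕ) : ℤ) - 1) w -
      ν * ∑ k ∈ Finset.Ico n (n + 1), (1 + ε₀) ^ ((2 : ℝ) * (k : ℤ)) * ∑ i : Fin 4, X i k w ^ 2 := ⟨_, rfl⟩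
  have hF'eq : ∀ w, F' w = botSum ε₀ α X ((n : ℤ) - 1) w - botSum ε₀ α X n w -
      ν * (1 + ε₀) ^ (2 * n) * ‖shellVec X n w‖ ^ 2 := by
    intro w
    rw [hF']
    simp only [Nat.Ico_succ_singleton, Finset.sum_singleton]
    have hidx : (((n + 1 : ℕ) : ℤ) - 1) = (n : ℤ) := by push_cast; ring
    have hw2 : (1 + ε₀) ^ ((2 : ℝ) * ((n : ℕ) : ℤ)) = (1 + ε₀) ^ (2 * n) := by
      rw [show (2 : ℝ) * (((n : ℕ) : ℤ) : ℝ) = ((2 * n : ℕ) : ℝ) by push_cast; ring, Real.rpow_natCast]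
    rw [hidx, hw2, norm_shellVec_sq]
    ring
  -- continuity and the derivative on the window
  have hXc : ∀ (i : Fin 4) (k : ℤ), ContinuousOn (X i k) (Icc t₀ x) := fun i k w hw =>
    ((hder i k w ⟨ht₀.trans hw.1, hw.2.trans hxT'.le⟩).continuousWithinAt).mono (Icc_subset_Icc ht₀ hxT'.le)
  have hFc : ContinuousOn F (Icc t₀ x) := by
    rw [hF]
    exact continuousOn_finsetSum _ fun k _ => continuousOn_finsetSum _ fun i _ =>
      continuousOn_const.mul ((hXc i k).pow 2)
  have hFder : ∀ w ∈ Ico t₀ x, HasDerivWithinAt F (F' w) (Ici w) w := by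
    intro w hw
    have hw0 : 0 ≤ w := ht₀.trans hw.1
    have hwT' : w < T' := hw.2.trans hxT'
    have h := hasDerivWithinAt_blockEnergy (ε₀ := ε₀) (ν := ν) hcan (fun i k => hder i k w ⟨hw0, hwT'.le⟩) (Nat.le_succ n)
    rw [hF, hF']
    exact h.mono_of_mem_nhdsWithin (mem_of_superset (Icc_mem_nhdsGE hwT') (Icc_subset_Icc hw0 le_rfl))
  -- the fence `Bc = (K+η) λ^{-n} / 2`
  obtain ⟨Bc, hBc⟩ : ∃ Bc : ℝ, Bc = (K + η) * r ^ n / 2 := ⟨_, rfl⟩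
  have hstart : F t₀ ≤ Bc := by
    rw [hFeq, hBc]
    have h1 := normSq_le_of_level hl0 (h0 n)
    rw [← hr] at h1
    have h2 : L₀ * r ^ n ≤ (K + η) * r ^ n := mul_le_mul_of_nonneg_right (by linarith) (pow_nonneg hr0.le n)
    linarith
  have hbound : ∀ w ∈ Ico t₀ x, F w = Bc → F' w < 0 := by
    intro w hw hFw
    have hwI : w ∈ Icc t₀ x := Ico_subset_Icc_self hw
    have hw0 : 0 ≤ w := ht₀.trans hw.1
    have hlev := hyp w hwI
    have hy : ‖shellVec X n w‖ ^ 2 = (K + η) * r ^ n := by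
      have := hFeq w
      rw [hFw, hBc] at this
      linarith
    -- inflow `Π_{n−1} ≤ 64 L₁ σ r λ^n`
    have hin : botSum ε₀ α X ((n : ℤ) - 1) w ≤ 64 * L₁ * σ * r * (1 + ε₀) ^ n := by
      rcases Nat.eq_zero_or_pos n with hn0 | hnpos
      · subst hn0
        rw [show ((0 : ℕ) : ℤ) - 1 = -1 by norm_num, botSum_neg_one_eq_zero hlow hw0]
        positivity
      · obtain ⟨n', rfl⟩ := Nat.exists_eq_add_one_of_ne_zero (Nat.pos_iff_ne_zero.1 hnpos)
        have hidx : (((n' + 1 : ℕ) : ℤ) - 1) = (n' : ℤ) := by push_cast; ring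
        rw [hidx]
        have hb := abs_botSum_le_of_levels hε hL₁0 hα1 X (hlev n') (hlev (n' + 1))
        rw [← hσ] at hb
        have heq : 64 * L₁ * σ * (1 + ε₀) ^ n' = 64 * L₁ * σ * r * (1 + ε₀) ^ (n' + 1) := by
          calc 64 * L₁ * σ * (1 + ε₀) ^ n' = 64 * L₁ * σ * (r * (1 + ε₀)) * (1 + ε₀) ^ n' := by
                rw [hrl, mul_one]
            _ = 64 * L₁ * σ * r * (1 + ε₀) ^ (n' + 1) := by rw [pow_succ]; ring
        linarith [le_abs_self (botSum ε₀ α X n' w)]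
    -- outflow `−Π_n ≤ 64 σ λ^{2n} ‖X_n‖²`
    have hout : -botSum ε₀ α X n w ≤ 64 * σ * ((K + η) * (1 + ε₀) ^ n) := by
      have hb := abs_botSum_le_of_level_succ hε hL₁0 hα1 X (n := n) (hlev (n + 1))
      rw [← hσ, hy] at hb
      have hQ : 64 * σ * (1 + ε₀) ^ (2 * n) * ((K + η) * r ^ n) = 64 * σ * ((K + η) * (1 + ε₀) ^ n) := by
        calc 64 * σ * (1 + ε₀) ^ (2 * n) * ((K + η) * r ^ n)
            = 64 * σ * ((K + η) * (1 + ε₀) ^ n) * ((1 + ε₀) ^ n * r ^ n) := by rw [two_mul, pow_add]; ring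
          _ = 64 * σ * ((K + η) * (1 + ε₀) ^ n) := by rw [hPr n, mul_one]
      linarith [neg_abs_le (botSum ε₀ α X n w)]
    -- dissipation `ν λ^{2n} ‖X_n‖² = ν (K+η) λ^n` at the fence
    have hdis : ν * (1 + ε₀) ^ (2 * n) * ‖shellVec X n w‖ ^ 2 = ν * ((K + η) * (1 + ε₀) ^ n) := by
      rw [hy]
      calc ν * (1 + ε₀) ^ (2 * n) * ((K + η) * r ^ n)
          = ν * ((K + η) * (1 + ε₀) ^ n) * ((1 + ε₀) ^ n * r ^ n) := by rw [two_mul, pow_add]; ring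
        _ = ν * ((K + η) * (1 + ε₀) ^ n) := by rw [hPr n, mul_one]
    -- the bracket is negative
    have e1 : ν / 2 * (K + η) ≤ (ν - 64 * σ) * (K + η) := mul_le_mul_of_nonneg_right (by linarith) hKη.le
    have e2 : ν / 2 * (128 * L₁ * σ / ν + η) ≤ ν / 2 * (K + η) :=
      mul_le_mul_of_nonneg_left (by linarith) (by positivity)
    have e3 : ν / 2 * (128 * L₁ * σ / ν + η) = 64 * L₁ * σ + ν * η / 2 := by
      field_simp
      ring
    have e4 : 64 * L₁ * σ * r ≤ 64 * L₁ * σ := mul_le_of_le_one_right (by positivity) hr1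
    have e5 : 0 < ν * η / 2 := by positivity
    have hbr : 64 * L₁ * σ * r + (64 * σ - ν) * (K + η) < 0 := by nlinarith [e1, e2, e3, e4, e5]
    have hP : 0 < (1 + ε₀) ^ n := pow_pos hl0 n
    have hPbr := mul_neg_of_pos_of_neg hP hbr
    rw [hF'eq, hdis]
    nlinarith [hin, hout, hPbr]
  have hfence := image_le_of_deriv_right_lt_deriv_boundary hFc hFder (B := fun _ => Bc) (B' := fun _ => 0) hstart
    (fun _ => hasDerivAt_const _ _) (fun w hw hFw => hbound w hw hFw)
  have hτ' : F τ ≤ Bc := hfence hτ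
  rw [hFeq, hBc] at hτ'
  have hyτ : ‖shellVec X n τ‖ ^ 2 ≤ (K + η) * r ^ n := by linarith
  calc (1 + ε₀) ^ n * ‖shellVec X n τ‖ ^ 2 ≤ (1 + ε₀) ^ n * ((K + η) * r ^ n) :=
        mul_le_mul_of_nonneg_left hyτ (pow_nonneg hl0.le n)
    _ = (K + η) * ((1 + ε₀) ^ n * r ^ n) := by ring
    _ = K + η := by rw [hPr n, mul_one]

end Summit.NavierStokesRegularity.NavierStokesRegularity.Theorems.MinimalViscousBlowup.ThresholdRay

end
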